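import Summits.QuantumFields.BalabanUV.Beta.GAN24.WhitneyRowDefectGauge
import Summits.QuantumFields.BalabanUV.Beta.GAN24.WhitneyRowDefectBound
import Summits.QuantumFields.BalabanUV.Beta.GAN24.MonotoneTorusEffectiveLimit
import Summits.QuantumFields.BalabanUV.Beta.PropagatorWoodburyFibreOpNorm

/-!
# `BalabanUV.Beta.GAN24.WhitneyRowDefectEnd` — binder row G-an2-4 ∕ (CONV-C), routes R1 ∕ R6 ∕ R7 at `U = 1`: THE HYPOTHESIS-FREE ENDs —
# route R1 on road P4's torus avatar CLOSED (first order), the value step and THE CAUCHY PROPERTY OF BAŁABAN's MINIMISERS UNDER WHITNEY PROLONGATION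
# in the scaled curl energy with the geometric rate `Lc^{−j}`, every `d`, every `Lc ≥ 1`, every unit torus, every level, every datum
# (unit b2b-balaban-gan24-p3, gen 49; v1 — the plug of `WhitneyRowDefectGauge` (gauge split, modulo `ρ`, `Λ`) and `WhitneyRowDefectBound` (`ρ_j`) with
# `MonotoneTorusEffectiveLimit.effAction_le_curlBound` (`Λ = ‖curlBound M‖`))

NOT IN PRINT; OUR PROOF ([folklore] plumbing BY NAME).  HONEST FRAMING (cell contract, verbatim): «discharging `BetaPertH` makes Bałaban's UV stability UNCONDITIONAL —
a real constructive-QFT result; it is NOT the continuum limit and NOT the Clay problem.»  HONEST DEPENDENCY (verbatim): «continuum YM on T⁴ ⇐ BetaPertH ∧ nine spine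
estimates (0/9 proved); BetaPertH ⇐ (D1) ∧ (D4) ∧ CAP+tail; G-an2-4 gates asym, D1 and NE2/3/4.»

WHAT THIS FILE PROVES (0 sorry, 0 `def`, nothing cited; `Λ := ‖curlBound M‖`, `K := |T₁×{1..d}|·(Lc + d)·|C_H(d,0)|`, `θ := Lc⁻¹`):
* §1 `norm_effAction_le` (`‖effAction k‖ ≤ ‖curlBound M‖`, Loewner ⟹ operator norm, `PropagatorWoodburyFibre.opNorm_le_opNorm_of_posSemidef`), `absRho_eq` (`|ρ_j| = K·θ^j`).
* §2 **`effAction_step_le_rate`**: `re⟨B,(effAction (j+1) − effAction j)B⟩ ≤ 2ΛK·θ^j·nsq B` — road P2's squeeze with the honest defect, hypothesis-free: route R1 («monotone +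
  trial-subspace squeeze») CLOSED at `U = 1` at first order (a second, variational proof of the value rate; the tree's `MonotoneTorusRate.effAction_succ_sub_le` has `Lc^{−2j}` by Fourier).
* §3 **`curlEnergy_HkOp_succ_sub_PcoLev_le_rate`**: `scal (j+1)·curlEnergy (H_{Lc^{j+1}}B − PcoLev j (H_{Lc^j}B)) ≤ (4ΛK + 2ΛK²)·θ^j·nsq B` — NEW: Bałaban's level-`(j+1)`
  minimiser and the Whitney prolongation of his level-`j` minimiser are `θ^{j∕2}`-close in the scaled curl-energy norm (route R7 (iii)'s energy-norm LEG RATE ∕ route R6's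
  (CONS)-class input, at `U = 1`); **`cauchy_whitney_HkOp`**: the census sentence `∃ C ≥ 0, ∀ j B, … ≤ C·(Lc⁻¹)^j·nsq B` (both clauses).
HONEST SCOPE.  `U = 1`, torus model; rate `Lc^{−j}` in the squared energy (first-order row defect), constants carry the unit-torus volume (crude sup bound) — (CONV-C)'s row
text allows `C₄(d, L, N)`; `θ < 1` iff `Lc ≥ 2`.  NOT (CONV-C), NOT D1, NOT `BetaPertH`, NOT continuum, NOT Clay; NEVER «G-an2-4 closed».
-/

noncomputable section

namespace Summit.QuantumFields.BalabanUV.Beta.GAN24.WhitneyRowDefectEnd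

open Matrix
open scoped BigOperators ComplexOrder Matrix.Norms.L2Operator
open Literature.MathematicalPhysics.QuantumFieldTheory.Balaban1983to89
open Literature.MathematicalPhysics.QuantumFieldTheory.Balaban1983to89.B5Prop11Plancherel (Tor fine)
open Literature.MathematicalPhysics.QuantumFieldTheory.Balaban1983to89.B5Prop11Lower (nsq nsq_nonneg)
open Literature.MathematicalPhysics.QuantumFieldTheory.Balaban1983to89.B5Hk163Torus (HkOp)
open Literature.MathematicalPhysics.QuantumFieldTheory.Balaban1983to89.B5Hk163Holder (CHolder163)
open Literature.MathematicalPhysics.QuantumFieldTheory.Balaban1983to89.Beta.FluctuationProjection (Jlift)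
open Summit.QuantumFields.BalabanUV.Beta.GAN24.MonotoneTorusTower (Lev sread hform hform_isHermitian scal curlEnergy)
open Summit.QuantumFields.BalabanUV.Beta.GAN24.MonotoneTorusEffective (effAction effAction_posSemidef)
open Summit.QuantumFields.BalabanUV.Beta.GAN24.MonotoneTorusEffectiveLimit (curlBound effAction_le_curlBound)
open Summit.QuantumFields.BalabanUV.Beta.GAN24.MonotoneShorted (harmExt)
open Summit.QuantumFields.BalabanUV.Beta.GAN24.MonotoneSqueeze (trial)
open Summit.QuantumFields.BalabanUV.Beta.GAN24.MonotoneTorusSqueeze (PcoLev PcoMat)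
open Summit.QuantumFields.BalabanUV.Beta.PropagatorWoodburyFibre (opNorm_le_opNorm_of_posSemidef)
open Summit.QuantumFields.BalabanUV.Beta.GAN24.WhitneyRowDefectGauge (squeeze_nsq_honest curlEnergy_HkOp_succ_sub_PcoLev_le)
open Summit.QuantumFields.BalabanUV.Beta.GAN24.WhitneyRowDefectBound (nsq_honestDefect_le)

variable {d : ℕ} (Lc : ℕ) [NeZero Lc] (M : Fin d → ℕ) [hM : ∀ μ, NeZero (M μ)]

/-! ## §1 The two letters: `Λ = ‖curlBound M‖` and `|ρ_j| = K·Lc^{−j}` -/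

/-- **`‖effAction k‖ ≤ ‖curlBound M‖`** — the Loewner bound `effAction k ≤ γ₁·curlMatᴴcurlMat` (`MonotoneTorusEffectiveLimit.effAction_le_curlBound`, twice the
printed (1.67) upper bound) read in the operator norm on the positive cone (`PropagatorWoodburyFibre.opNorm_le_opNorm_of_posSemidef`). [folklore] -/
theorem norm_effAction_le (k : ℕ) : ‖effAction Lc M k‖ ≤ ‖curlBound M‖ :=
  opNorm_le_opNorm_of_posSemidef (effAction_posSemidef Lc M k) (effAction_le_curlBound Lc M k)

/-- `WhitneyRowDefectBound.nsq_honestDefect_le` with the (sign-safe) letter `|ρ_j|`. [folklore] -/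
theorem nsq_honestDefect_le_abs (j : ℕ) (B : Tor M × Fin d → ℂ) :
    nsq (sread Lc M (j + 1) *ᵥ (PcoMat Lc M j *ᵥ (HkOp (Lc ^ j) M *ᵥ B)) - B)
      ≤ |(Fintype.card (Tor M × Fin d) : ℝ) * ((Lc : ℝ) + d) * CHolder163 d 0 / (Lc : ℝ) ^ j| ^ 2 * nsq B := by
  rw [sq_abs]
  exact nsq_honestDefect_le Lc M j B

/-- `|ρ_j| = K·(Lc⁻¹)^j`, `K = |T₁×{1..d}|·(Lc + d)·|C_H(d,0)|`. [folklore] -/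
theorem absRho_eq (j : ℕ) :
    |(Fintype.card (Tor M × Fin d) : ℝ) * ((Lc : ℝ) + d) * CHolder163 d 0 / (Lc : ℝ) ^ j|
      = (Fintype.card (Tor M × Fin d) : ℝ) * ((Lc : ℝ) + d) * |CHolder163 d 0| * ((Lc : ℝ)⁻¹) ^ j := by
  have hL : (0 : ℝ) < (Lc : ℝ) ^ j := pow_pos (Nat.cast_pos.mpr (Nat.pos_of_ne_zero (NeZero.ne Lc))) j
  rw [abs_div, abs_mul, abs_mul, abs_of_nonneg (Nat.cast_nonneg _), abs_of_nonneg (by positivity : (0 : ℝ) ≤ (Lc : ℝ) + d), abs_of_pos hL,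
    div_eq_mul_inv, inv_pow]

/-- `((Lc⁻¹)^j)² ≤ (Lc⁻¹)^j` (`0 ≤ Lc⁻¹ ≤ 1`). [folklore] -/
theorem theta_pow_sq_le (j : ℕ) : (((Lc : ℝ)⁻¹) ^ j) ^ 2 ≤ ((Lc : ℝ)⁻¹) ^ j := by
  have h1 : (1 : ℝ) ≤ Lc := by exact_mod_cast Nat.one_le_iff_ne_zero.mpr (NeZero.ne Lc)
  have hθ0 : (0 : ℝ) ≤ (Lc : ℝ)⁻¹ := inv_nonneg.mpr (by linarith)
  have hθ1 : (Lc : ℝ)⁻¹ ≤ 1 := inv_le_one_of_one_le₀ h1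
  have hp0 : 0 ≤ ((Lc : ℝ)⁻¹) ^ j := pow_nonneg hθ0 j
  have hp1 : ((Lc : ℝ)⁻¹) ^ j ≤ 1 := pow_le_one₀ hθ0 hθ1
  nlinarith

/-! ## §2 Route R1 closed at `U = 1` (first order): the value step -/

/-- **THE VALUE STEP, HYPOTHESIS-FREE**: `re⟨B,(effAction (j+1) − effAction j)B⟩ ≤ 2·‖curlBound M‖·K·(Lc⁻¹)^j·nsq B` for every datum `B` — road P2's squeeze
(`MonotoneTorusSqueeze.effAction_squeeze`) with the honest row defect of Bałaban's minimiser (`WhitneyRowDefectGauge.squeeze_nsq_honest` + `WhitneyRowDefectBound.nsq_honestDefect_le`).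
[folklore] -/
theorem effAction_step_le_rate (j : ℕ) (B : Tor M × Fin d → ℂ) :
    (star B ⬝ᵥ ((effAction Lc M (j + 1) - effAction Lc M j) *ᵥ B)).re
      ≤ 2 * ‖curlBound M‖ * ((Fintype.card (Tor M × Fin d) : ℝ) * ((Lc : ℝ) + d) * |CHolder163 d 0|) * ((Lc : ℝ)⁻¹) ^ j * nsq B := by
  have h := (squeeze_nsq_honest Lc M j (norm_effAction_le Lc M (j + 1)) (abs_nonneg _) (nsq_honestDefect_le_abs Lc M j) B).1
  rw [absRho_eq] at h
  linarith

/-! ## §3 The Cauchy property of Bałaban's minimisers under Whitney prolongation, with the geometric rate -/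

/-- **THE CAUCHY PROPERTY OF BAŁABAN's MINIMISERS UNDER WHITNEY PROLONGATION, HYPOTHESIS-FREE**: for every `d`, `Lc ≥ 1`, unit torus `M`, level `j` and datum `B`,
`scal (j+1)·curlEnergy (H_{Lc^{j+1}}B − PcoLev j (H_{Lc^j}B)) ≤ (4ΛK + 2ΛK²)·(Lc⁻¹)^j·nsq B`, `Λ = ‖curlBound M‖`, `K = |T₁×{1..d}|·(Lc + d)·|C_H(d,0)|` — Bałaban's
(1.63) minimiser one level up and the cubical-Whitney prolongation of his minimiser are `(Lc^{−1∕2})^j`-close in the scaled curl-energy norm. [folklore] -/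
theorem curlEnergy_HkOp_succ_sub_PcoLev_le_rate (j : ℕ) (B : Tor M × Fin d → ℂ) :
    scal (d := d) Lc (j + 1) * curlEnergy (fine (Lc ^ (j + 1)) M) (HkOp (Lc ^ (j + 1)) M *ᵥ B - PcoLev Lc M j (HkOp (Lc ^ j) M *ᵥ B))
      ≤ (4 * ‖curlBound M‖ * ((Fintype.card (Tor M × Fin d) : ℝ) * ((Lc : ℝ) + d) * |CHolder163 d 0|)
          + 2 * ‖curlBound M‖ * ((Fintype.card (Tor M × Fin d) : ℝ) * ((Lc : ℝ) + d) * |CHolder163 d 0|) ^ 2) * ((Lc : ℝ)⁻¹) ^ j * nsq B := by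
  have h := curlEnergy_HkOp_succ_sub_PcoLev_le Lc M j (norm_effAction_le Lc M (j + 1)) (abs_nonneg _) (nsq_honestDefect_le_abs Lc M j) B
  rw [absRho_eq] at h
  set K := (Fintype.card (Tor M × Fin d) : ℝ) * ((Lc : ℝ) + d) * |CHolder163 d 0| with hK
  set Λ := ‖curlBound M‖ with hΛ
  set θj := ((Lc : ℝ)⁻¹) ^ j with hθ
  have hK0 : 0 ≤ K := by positivity
  have hΛ0 : 0 ≤ Λ := norm_nonneg _
  have hB0 : 0 ≤ nsq B := nsq_nonneg B
  have hsq := theta_pow_sq_le Lc j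
  refine h.trans ?_
  have e : (4 * Λ * (K * θj) + 2 * Λ * (K * θj) ^ 2) * nsq B
      = (4 * Λ * K) * θj * nsq B + (2 * Λ * K ^ 2) * (θj ^ 2) * nsq B := by ring
  rw [e]
  have hle : (2 * Λ * K ^ 2) * (θj ^ 2) * nsq B ≤ (2 * Λ * K ^ 2) * θj * nsq B :=
    mul_le_mul_of_nonneg_right (mul_le_mul_of_nonneg_left hsq (by positivity)) hB0
  linarith

/-- **THE CENSUS SENTENCE** (both clauses, one constant): for every unit torus there is `C ≥ 0` with, for ALL levels `j` and ALL data `B`,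
(i) `re⟨B,(effAction (j+1) − effAction j)B⟩ ≤ C·(Lc⁻¹)^j·nsq B` and (ii) `scal (j+1)·curlEnergy (H_{Lc^{j+1}}B − PcoLev j (H_{Lc^j}B)) ≤ C·(Lc⁻¹)^j·nsq B` —
geometric (`Lc⁻¹ < 1`) as soon as `Lc ≥ 2`.  Route R1 at `U = 1` closed at first order; route R7 (iii) ∕ route R6 (CONS)-class leg input at `U = 1` supplied in energy currency. [folklore] -/
theorem cauchy_whitney_HkOp :
    ∃ C : ℝ, 0 ≤ C ∧ ∀ (j : ℕ) (B : Tor M × Fin d → ℂ),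
      (star B ⬝ᵥ ((effAction Lc M (j + 1) - effAction Lc M j) *ᵥ B)).re ≤ C * ((Lc : ℝ)⁻¹) ^ j * nsq B
        ∧ scal (d := d) Lc (j + 1) * curlEnergy (fine (Lc ^ (j + 1)) M) (HkOp (Lc ^ (j + 1)) M *ᵥ B - PcoLev Lc M j (HkOp (Lc ^ j) M *ᵥ B))
            ≤ C * ((Lc : ℝ)⁻¹) ^ j * nsq B := by
  set K := (Fintype.card (Tor M × Fin d) : ℝ) * ((Lc : ℝ) + d) * |CHolder163 d 0| with hK
  set Λ := ‖curlBound M‖ with hΛ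
  have hK0 : 0 ≤ K := by positivity
  have hΛ0 : 0 ≤ Λ := norm_nonneg _
  refine ⟨4 * Λ * K + 2 * Λ * K ^ 2, by positivity, fun j B => ⟨?_, ?_⟩⟩
  · have h := effAction_step_le_rate Lc M j B
    have hθ : 0 ≤ ((Lc : ℝ)⁻¹) ^ j := pow_nonneg (inv_nonneg.mpr (Nat.cast_nonneg _)) j
    have hB0 : 0 ≤ nsq B := nsq_nonneg B
    rw [← hK, ← hΛ] at h
    nlinarith [mul_nonneg (mul_nonneg (mul_nonneg hΛ0 hK0) hθ) hB0, mul_nonneg (mul_nonneg (mul_nonneg hΛ0 (sq_nonneg K)) hθ) hB0]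
  · have h := curlEnergy_HkOp_succ_sub_PcoLev_le_rate Lc M j B
    rw [← hK, ← hΛ] at h
    exact h

end Summit.QuantumFields.BalabanUV.Beta.GAN24.WhitneyRowDefectEnd

end
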